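import Summits.CriticalPhenomena.SAWScalingLimit.Theorems.SAWRenewalTightnessRoomPassageDefs
import Literature.Probability.RandomPlanarGeometry.DrivingFunctionMeasurable
import Literature.Probability.RandomPlanarGeometry.SLEConvergenceCriterion
import HarnessLib

/-!
# Events and limit objects of the lattice-to-continuum passage of the line `room-entropy-wright-fisher`
(crux `SubseqIdentification`, stmt-CriticalPhenomena-0783; lead prover, crux protocol; skeleton
`Summits/CriticalPhenomena/SAWScalingLimit/Cruxes/SubseqIdentification/Lines/room_entropy_wright_fisher.lean`,
reshape r7 of the continuation seat)

Second companion of `Theorems/SAWRenewalTightnessRoomEntropyDefs.lean` (p78923) and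
`Theorems/SAWRenewalTightnessRoomPassageDefs.lean` (p103797). Reshape r7 follows the refutation of the
exact driver predicate `DrivesPast` at EVERY past (a walk crossing the image of its stem swallows a
pocket; pasts inside the pocket share hull and capacity but not driving value): the drivers become
APPROXIMATE and prefix-consistent only beyond a small capacity threshold `S₀`, their fidelity is claimed
in probability along describable mesh sequences, and stem contacts after the walk has left a small ball
around `a` are excluded by a NO-RETURN event (derived, in the line, from SAW reversal symmetry and the
describability of limits in the swapped domain). This file only DEFINES the objects those statements
quantify over — events (sets of walks), the weak-limit hypothesis along a mesh sequence, and the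
frozen-before-`S₀` limit driver; no statement of the line is asserted here:

* `WeakLimitAlong D a b μ s` — the SAW curve laws along the meshes `s n` converge weakly to `μ`
  (bounded continuous test functions on `CurveClass ℂ`; the `IsSubseqLimitLaw` data with its sequence
  exposed);
* `noReturnEvent D δ a b R r` — the walk is at distance `≥ R` from `a = D.pt 0` at some vertex and at
  distance `≤ r` at a LATER vertex ("returns to the `r`-ball after leaving the `R`-ball");
* `NoReturnAlong D a b s` — along the meshes `s n`, for every `R, ε > 0` some `r > 0` makes the
  no-return event `ε`-unlikely for all large `n`;
* `capacityEvent φ T ε` — the running capacity of the pasts never exceeds `T`, or some past of capacity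
  `≤ T` is followed by a one-step capacity increment `> ε` (the bad event of the first-passage clocks);
* `fidelityEvent φ V S₀ w ρ` — at some past with `S₀ ≤ capacity ≤ (Im w)²/16` the time-capped room
  observable of the driver `V γ` at that capacity time misses the hull functional
  `hullRoomObs K_n ξ_n w` by more than `ρ`;
* `roomDataEvent D φ δ a b z w R r ε` — at some past of capacity `≤ (Im w)²/16` along which the walk has
  not returned to the `r`-ball around `a` after leaving the `R`-ball, the exact Doob martingale
  `roomDoob` misses the hull functional by more than `ε`;
* `frozenDriver φ S₀ c` — the continuous path `u ↦ W_{u ∨ S₀}(c)`, `W = drivingFunction φ`: the limit in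
  law of the threshold-`S₀` lattice drivers.

Sources: the line card `Lines/room-entropy-wright-fisher.md`; the drivers worker's refutation and the
formulation report (crux evidence, 2026-08-16); G. F. Lawler, *Conformally Invariant Processes in the
Plane* (2005) §3.4, §4.1; A. Kemppainen, S. Smirnov, Ann. Probab. 45 (2017) §1.2 (driving processes of
random curves, convergence in the three topologies).
-/

noncomputable section

open MeasureTheory Filter Topology Set
open scoped NNReal ENNReal Classical BigOperators
open Literature.Probability.LatticeModels
open Literature.Probability.RandomPlanarGeometry
open UpperHalfPlane (upperHalfPlaneSet)

namespace Summit.CriticalPhenomena.SAWScalingLimit.Theorems.SubseqIdentification.RoomEntropy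

/-! ## Weak limits along a mesh sequence -/

/-- **The SAW curve laws along the meshes `s n` converge weakly to `μ`**: for every bounded continuous
`f` on the curve space, `E_{s n}[f(curve)] → ∫ f dμ` (the data of `IsSubseqLimitLaw` with its sequence
exposed). [folklore] -/
def WeakLimitAlong (D : DobrushinDomain) (a b : ℝ → Site 2) (μ : Measure (CurveClass ℂ))
    (s : ℕ → ℝ) : Prop :=
  ∀ f : BoundedContinuousFunction (CurveClass ℂ) ℝ,
    Tendsto (fun n => ∫ γ, f γ.curve ∂(SAW.law D.carrier (s n) (a (s n)) (b (s n))))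
      atTop (𝓝 (∫ x, f x ∂μ))

/-! ## Events (sets of self-avoiding walks of `Ω_δ`) -/

/-- **The no-return event**: some vertex of the walk is at distance `≥ R` from `a = D.pt 0` and a LATER
vertex is at distance `≤ r` from it. [folklore] -/
def noReturnEvent (D : DobrushinDomain) (δ : ℝ) (a b : Site 2) (R r : ℝ) :
    Set (SAW.DomainSAW D.carrier δ a b) :=
  {γ | ∃ i k : ℕ, i < k ∧ R ≤ dist (meshPoint δ (γ.walk.getVert i)) (D.pt 0) ∧
    dist (meshPoint δ (γ.walk.getVert k)) (D.pt 0) ≤ r}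

/-- **No return to the root along the meshes `s n`**: for every `R, ε > 0` there is `r > 0` such that,
for all large `n`, the no-return event `noReturnEvent D (s n) (a (s n)) (b (s n)) R r` has probability
`≤ ε` under the SAW law. (For describable subsequential limits this follows from the lattice reversal
symmetry of the SAW law and the describability of the reversed limit in the swapped domain: a described
class reaches its target only at the final time.) [folklore] -/
def NoReturnAlong (D : DobrushinDomain) (a b : ℝ → Site 2) (s : ℕ → ℝ) : Prop :=
  ∀ R ε : ℝ, 0 < R → 0 < ε → ∃ r : ℝ, 0 < r ∧ ∀ᶠ n in atTop,
    SAW.law D.carrier (s n) (a (s n)) (b (s n)) (noReturnEvent D (s n) (a (s n)) (b (s n)) R r)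
      ≤ ENNReal.ofReal ε

/-- **The capacity bad event at horizon `T` and tolerance `ε`**: the capacities of the pasts never exceed
`T` (so no first passage of level `T` exists), or some past of capacity `≤ T` is followed by a one-step
capacity increment `> ε` (overshoot of the first-passage clock). [folklore] -/
def capacityEvent {D : DobrushinDomain} (φ : ConformalEquiv upperHalfPlaneSet D.carrier) {δ : ℝ}
    {a b : Site 2} (T ε : ℝ) : Set (SAW.DomainSAW D.carrier δ a b) :=
  {γ | (∀ k : ℕ, LatticeSlit.capTime φ (prefixAt γ k) ≤ T) ∨
    ∃ k : ℕ, LatticeSlit.capTime φ (prefixAt γ k) ≤ T ∧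
      ε < LatticeSlit.capTime φ (prefixAt γ (k + 1)) - LatticeSlit.capTime φ (prefixAt γ k)}

/-- **The fidelity bad event** of a lattice driver assignment `V` (threshold `S₀`, point `w`, tolerance
`ρ`): at some past with `S₀ ≤ capacity ≤ (Im w)²/16`, the time-capped room observable of the driver
`V γ` at that capacity time misses the hull functional `hullRoomObs K_n ξ_n w` of the past by more than
`ρ`. [folklore] -/
def fidelityEvent {D : DobrushinDomain} (φ : ConformalEquiv upperHalfPlaneSet D.carrier) {δ : ℝ}
    {a b : Site 2} (V : SAW.DomainSAW D.carrier δ a b → C(ℝ≥0, ℝ)) (S₀ : ℝ≥0) (w : ℂ) (ρ : ℝ) :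
    Set (SAW.DomainSAW D.carrier δ a b) :=
  {γ | ∃ k : ℕ, (S₀ : ℝ) ≤ LatticeSlit.capTime φ (prefixAt γ k) ∧
    LatticeSlit.capTime φ (prefixAt γ k) ≤ w.im ^ 2 / 16 ∧
    ρ < |roomObsCap (V γ) w (LatticeSlit.capTime φ (prefixAt γ k)).toNNReal -
      hullRoomObs (LatticeSlit.pastHull φ (prefixAt γ k))
        (LatticeSlit.drivingValue φ (prefixAt γ k)) w|}

/-- **The room-data bad event** at the lattice point `z` (near `φ w`), scales `R > r > 0` and tolerance
`ε`: at some past of capacity `≤ (Im w)²/16` along which the walk has not come back within `r` of `a`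
after having been at distance `≥ R` (so every fictitious pocket against the stem lies in `B(a, R)`), the
exact Doob martingale `roomDoob` of the terminal room deficit misses the hull functional
`hullRoomObs K_n ξ_n w` by more than `ε`. [folklore] -/
def roomDataEvent (D : DobrushinDomain) (φ : ConformalEquiv upperHalfPlaneSet D.carrier) (δ : ℝ)
    (a b z : Site 2) (w : ℂ) (R r ε : ℝ) : Set (SAW.DomainSAW D.carrier δ a b) :=
  {γ | ∃ n : ℕ, LatticeSlit.capTime φ (prefixAt γ n) ≤ w.im ^ 2 / 16 ∧
    (∀ i k : ℕ, i < k → k ≤ n → R ≤ dist (meshPoint δ (γ.walk.getVert i)) (D.pt 0) →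
      r < dist (meshPoint δ (γ.walk.getVert k)) (D.pt 0)) ∧
    ε < |roomDoob D δ a b z γ n -
      hullRoomObs (LatticeSlit.pastHull φ (prefixAt γ n)) (LatticeSlit.drivingValue φ (prefixAt γ n)) w|}

/-! ## The frozen limit driver -/

/-- **The driving path frozen before `S₀`**: `u ↦ W_{u ∨ S₀}(c)`, `W = drivingFunction φ c`, as a point
of `C([0, ∞), ℝ)` — the limit in law of lattice drivers that forget the past of capacity `< S₀` (it tends
to the driving path itself as `S₀ → 0`, locally uniformly). [folklore] -/
def frozenDriver {D : DobrushinDomain} (φ : ConformalEquiv upperHalfPlaneSet D.carrier) (S₀ : ℝ≥0)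
    (c : CurveClass ℂ) : C(ℝ≥0, ℝ) :=
  ⟨fun u => drivingFunction φ c (max u S₀),
    (continuous_drivingFunction φ c).comp (continuous_id.max continuous_const)⟩

/-! ## Trivial API (sanity of the vocabulary) -/

/-- Unfolding the frozen driver. [folklore] -/
@[simp] theorem frozenDriver_apply {D : DobrushinDomain} (φ : ConformalEquiv upperHalfPlaneSet D.carrier)
    (S₀ : ℝ≥0) (c : CurveClass ℂ) (u : ℝ≥0) :
    frozenDriver φ S₀ c u = drivingFunction φ c (max u S₀) :=
  rfl

/-- The no-return event only shrinks when the return radius shrinks. [folklore] -/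
theorem noReturnEvent_mono (D : DobrushinDomain) (δ : ℝ) (a b : Site 2) (R : ℝ) {r r' : ℝ}
    (h : r ≤ r') : noReturnEvent D δ a b R r ⊆ noReturnEvent D δ a b R r' := by
  rintro γ ⟨i, k, hik, hR, hr⟩
  exact ⟨i, k, hik, hR, hr.trans h⟩

/-- The time-capped observable in its long form (the spelling of `RoomMartingaleLimitCap`). [folklore] -/
theorem roomObsCap_eq (W : ℝ≥0 → ℝ) (w : ℂ) (u : ℝ≥0) :
    roomObsCap W w u = roomObsStopped W w ⌈w.im ^ 2 / 16⌉₊ (min u (Real.toNNReal (w.im ^ 2 / 16))) :=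
  rfl

end Summit.CriticalPhenomena.SAWScalingLimit.Theorems.SubseqIdentification.RoomEntropy

end
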